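import Literature.Computability.MetaComplexity.GGM
import HarnessLib

/-!
# The GGM / Razborov–Rudich hybrid argument in averaged form (proofs)

Part of the proof architecture of the named fact `AllenderEtAl2006_MCSP_universalInverter`
(`MCSPUniversalInverter.lean`; Allender–Buhrman–Koucký–van Melkebeek–Ronneburger 2006, Thm. 45
with §4.2). The printed proof of Thm. 45 (p. 24 of the author version) turns the statistical
test `L` into "a probabilistic oracle machine `M` using `L` that distinguishes `G_y` from the
uniform distribution", "as in [RR97]" — i.e. by the hybrid argument over the GGM tree
(Razborov–Rudich 1997, proof of Thm. 4.1; Arora–Barak 2009, proof of Thm. 9.17: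
"`E_{i ∈ [Tn]}[pᵢ − pᵢ₋₁] ≥ ε/(Tn)`"). `MetaComplexity/GGM.lean` proves the finite core of that
argument in the NON-uniform form needed for the natural-proofs barrier
(`exists_distinguisher`: SOME hybrid step at SOME fixing of the fresh labels distinguishes). A
uniform machine cannot be handed the good step and fixing; it samples them. This file proves the
corresponding AVERAGED form from the same counting identities (`hybCount_zero`,
`hybCount_last_mul`, `card_mul_hybCount_succ`, `card_mul_hybCount_self`):

* `distLab_of_two_pow_sub_one_le`, `distFun_of_two_pow_sub_one_le` — at a step number
  `i ≥ 2ⁿ − 1` (no internal node is numbered `i`) the distinguisher tree never reads the challenge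
  and coincides with hybrid `i` (a fully re-randomised tree);
* `sum_card_ideal_eq`, `sum_card_real_eq` — summed over ALL step numbers `i < 2ⁿ` and all samples
  `ω`, the acceptance counts of the distinguisher tree on a uniform challenge, resp. on the
  pseudo-random challenge `(g 0 s, g 1 s)`, are `|Bool → σ| · Σᵢ hybCount (i+1)`, resp.
  `|σ| · Σᵢ hybCount i`;
* **`hybrid_average_advantage`** — hence, if the test rejects every GGM function and accepts at
  least a `B`-fraction of all functions, the distinguisher that picks `i < 2ⁿ` and `ω` uniformly
  at random has advantage `≥ B / 2ⁿ` (telescoping: `(p_{2ⁿ} − p₀)/2ⁿ`, `p₀ = 0`, `p_{2ⁿ} ≥ B`).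

Theorems only; the vocabulary (`ggmLab`, `hybLab`, `distLab`, `Sample`, `hybFun`, `distFun`,
`hybCount`) is that of `MetaComplexity/GGM.lean`.

## References

* E. Allender, H. Buhrman, M. Koucký, D. van Melkebeek, D. Ronneburger, *Power from random
  strings*, SIAM J. Comput. 35(6) (2006) [AllenderEtAl2006]: proof of Thm. 45 (p. 24).
* A. A. Razborov, S. Rudich, *Natural proofs*, JCSS 55 (1997) [RazborovRudich1997]: proof of
  Thm. 4.1.
* S. Arora, B. Barak, *Computational Complexity: A Modern Approach*, CUP 2009 [AroraBarak2009]: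
  proof of Thm. 9.17 (p. 228, the hybrid argument with a uniformly random step `i`).
* O. Goldreich, S. Goldwasser, S. Micali, *How to construct random functions*, J. ACM 33 (1986)
  [GoldreichGoldwasserMicali1986], §3.3 (proof of the Main Theorem).
-/

namespace Literature.Computability.MetaComplexity

open Complexity Finset

variable {σ : Type*} {n : ℕ}

/-! ### Beyond the internal nodes the challenge is never read -/

/-- At a step number `i ≥ 2ⁿ − 1` every node of depth `≤ n` below the root of the distinguisher
tree carries a fresh label: the challenge `z` is never read (no internal node is numbered `i`).
[folklore] [cite: AroraBarak2009, proof of Thm. 9.17 p. 228] -/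
theorem distLab_of_two_pow_sub_one_le {g : Bool → σ → σ} {ρ : ℕ → Bool → σ} {x : σ} {d i : ℕ}
    (hi : 2 ^ n - 1 ≤ i) (hd : d < n) (z : Bool → σ) (p : Fin (d + 1) → Bool) :
    distLab g ρ x i z (d + 1) p = ρ (nodeIdx d (Fin.tail p)) (p 0) := by
  have h1 := nodeIdx_lt (Fin.tail p)
  have h2 : 2 ^ (d + 1) ≤ 2 ^ n := Nat.pow_le_pow_right (by norm_num) hd
  have h : nodeIdx d (Fin.tail p) < i := by omega
  simp [distLab_succ, h]

/-- At a step number `i ≥ 2ⁿ − 1` the leaf function of the distinguisher tree does not depend on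
the challenge and equals the leaf function of hybrid `i`. [folklore]
[cite: AroraBarak2009, proof of Thm. 9.17 p. 228] -/
theorem distFun_of_two_pow_sub_one_le [Inhabited σ] {g : Bool → σ → σ} {o : σ → Bool} {i : ℕ}
    (hn : 0 < n) (hi : 2 ^ n - 1 ≤ i) (ω : Sample σ n) (z : Bool → σ) :
    distFun g o ω i z = hybFun g o ω i := by
  obtain ⟨m, rfl⟩ : ∃ m, n = m + 1 := ⟨n - 1, by omega⟩
  funext y
  simp only [distFun, hybFun]
  rw [distLab_of_two_pow_sub_one_le hi (Nat.lt_succ_self m),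
    hybLab_last hi (Nat.lt_succ_self m)]

/-- Hybrids `2ⁿ − 1` and `2ⁿ` coincide (both fully re-randomised). [folklore]
[cite: AroraBarak2009, proof of Thm. 9.17 p. 228] -/
theorem hybFun_two_pow_eq [Inhabited σ] {g : Bool → σ → σ} {o : σ → Bool} (hn : 0 < n)
    (ω : Sample σ n) : hybFun g o ω (2 ^ n) = hybFun g o ω (2 ^ n - 1) := by
  obtain ⟨m, rfl⟩ : ∃ m, n = m + 1 := ⟨n - 1, by omega⟩
  funext y
  simp only [hybFun]
  rw [hybLab_last (i := 2 ^ (m + 1)) (Nat.sub_le _ _) (Nat.lt_succ_self m),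
    hybLab_last (i := 2 ^ (m + 1) - 1) le_rfl (Nat.lt_succ_self m)]

/-! ### The acceptance counts summed over all steps -/

section Sums

variable [Fintype σ] [Inhabited σ] (g : Bool → σ → σ) (o : σ → Bool)
  (T : ((Fin n → Bool) → Bool) → Bool)

/-- **Uniform challenge, all steps**: `Σ_{i < 2ⁿ} Σ_ω #{z | T (distinguisher tree at i, z)} =
|Bool → σ| · Σ_{i < 2ⁿ} hybCount (i + 1)` (`card_mul_hybCount_succ` summed over `i`).
[cite: AroraBarak2009, proof of Thm. 9.17 p. 228] -/
theorem sum_card_ideal_eq :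
    ∑ i : Fin (2 ^ n), ∑ ω : Sample σ n, #{z : Bool → σ | T (distFun g o ω i z) = true} =
      Fintype.card (Bool → σ) * ∑ i : Fin (2 ^ n), hybCount g o T ((i : ℕ) + 1) := by
  rw [Finset.mul_sum]
  exact Finset.sum_congr rfl fun i _ => (card_mul_hybCount_succ (g := g) (o := o) (T := T) i.isLt).symm

/-- **Pseudo-random challenge, all steps**: `Σ_{i < 2ⁿ} Σ_ω #{s | T (distinguisher tree at i,
(g 0 s, g 1 s))} = |σ| · Σ_{i < 2ⁿ} hybCount i` — for an internal node `i` by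
`card_mul_hybCount_self`, and at `i = 2ⁿ − 1` because the challenge is not read
(`distFun_of_two_pow_sub_one_le`). [cite: AroraBarak2009, proof of Thm. 9.17 p. 228] -/
theorem sum_card_real_eq (hn : 0 < n) :
    ∑ i : Fin (2 ^ n), ∑ ω : Sample σ n,
        #{s : σ | T (distFun g o ω i fun b => g b s) = true} =
      Fintype.card σ * ∑ i : Fin (2 ^ n), hybCount g o T i := by
  classical
  rw [Finset.mul_sum]
  refine Finset.sum_congr rfl fun i _ => ?_
  by_cases hi : (i : ℕ) < 2 ^ n - 1
  · -- internal node `i = (D, q)`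
    have hD : depthOf i < n := depthOf_lt_of_lt hi
    have h := card_mul_hybCount_self (g := g) (o := o) (T := T) (pathOf i) hD
    rw [nodeIdx_pathOf] at h
    exact h.symm
  · -- `i = 2ⁿ − 1`: the challenge is not read
    have hi' : 2 ^ n - 1 ≤ (i : ℕ) := Nat.le_of_not_lt hi
    have hconst : ∀ (ω : Sample σ n) (s : σ),
        T (distFun g o ω i fun b => g b s) = T (hybFun g o ω i) := fun ω s => by
      rw [distFun_of_two_pow_sub_one_le hn hi']
    simp only [hconst]
    rw [hybCount, Finset.card_eq_sum_ones, Finset.mul_sum, Finset.sum_filter]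
    refine Finset.sum_congr rfl fun ω _ => ?_
    by_cases hT : T (hybFun g o ω i) = true
    · simp [hT]
    · simp [hT]

/-- The telescoping sum of the hybrid counts. [folklore] -/
theorem sum_hybCount_succ_sub (hn : 0 < n) :
    ((∑ i : Fin (2 ^ n), (hybCount g o T ((i : ℕ) + 1) : ℝ)) -
        ∑ i : Fin (2 ^ n), (hybCount g o T i : ℝ)) =
      hybCount g o T (2 ^ n - 1) - hybCount g o T 0 := by
  rw [Fin.sum_univ_eq_sum_range (fun i => (hybCount g o T (i + 1) : ℝ)),
    Fin.sum_univ_eq_sum_range (fun i => (hybCount g o T i : ℝ)), ← Finset.sum_sub_distrib,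
    Finset.sum_range_sub (fun i => (hybCount g o T i : ℝ))]
  have hlast : hybCount g o T (2 ^ n) = hybCount g o T (2 ^ n - 1) := by
    simp only [hybCount, hybFun_two_pow_eq hn]
  rw [hlast]

end Sums

/-! ### The averaged hybrid lemma -/

/-- **The hybrid argument, averaged over a uniformly random step** (the uniform form of
Razborov–Rudich 1997, proof of Thm. 4.1; Arora–Barak 2009, p. 228). Let the test `T` reject
every GGM function `y ↦ o (ggmLab g x (m+1) y)` and accept at least `B · 2^{2^{m+1}}` Boolean
functions, and let `flip` be an involution of `σ` negating the read-out `o`. Then the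
distinguisher which draws a step number `i < 2^{m+1}` and a sample `ω` of fresh labels uniformly
at random and applies `T` to the leaf function of the distinguisher tree accepts a uniform
challenge `z : Bool → σ` with probability at least `B / 2^{m+1}` more than the pseudo-random
challenge `z = (g 0 s, g 1 s)`, `s ∈ σ` uniform: the two acceptance probabilities are
`(Σᵢ p_{i+1}) / 2^{m+1}` and `(Σᵢ pᵢ) / 2^{m+1}` (`sum_card_ideal_eq`, `sum_card_real_eq`), whose
difference telescopes to `(p_{2^{m+1}} − p₀) / 2^{m+1}` with `p₀ = 0` (`hybCount_zero`) and
`p_{2^{m+1}} = p_{2^{m+1}−1} ≥ B` (`hybCount_last_mul`).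
[cite: RazborovRudich1997, Thm. 4.1 proof] [cite: AroraBarak2009, proof of Thm. 9.17 p. 228]
[cite: AllenderEtAl2006, Thm. 45 (proof, p. 24: "as in [RR97], this gives us a probabilistic oracle machine")] -/
theorem hybrid_average_advantage [Fintype σ] [Inhabited σ] {m : ℕ} (g : Bool → σ → σ)
    (o : σ → Bool) {flip : σ → σ} (ho : ∀ s, o (flip s) = !o s) (hflip : ∀ s, flip (flip s) = s)
    (T : ((Fin (m + 1) → Bool) → Bool) → Bool)
    (hA : ∀ x : σ, T (fun y => o (ggmLab g x (m + 1) y)) = false) {B : ℝ}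
    (hB : B * 2 ^ 2 ^ (m + 1) ≤ #{h : (Fin (m + 1) → Bool) → Bool | T h = true}) :
    B / 2 ^ (m + 1) ≤
      (∑ i : Fin (2 ^ (m + 1)), ∑ ω : Sample σ (m + 1),
          (#{z : Bool → σ | T (distFun g o ω i z) = true} : ℝ)) /
        (2 ^ (m + 1) * Fintype.card (Sample σ (m + 1)) * Fintype.card (Bool → σ)) -
      (∑ i : Fin (2 ^ (m + 1)), ∑ ω : Sample σ (m + 1),
          (#{s : σ | T (distFun g o ω i fun b => g b s) = true} : ℝ)) /
        (2 ^ (m + 1) * Fintype.card (Sample σ (m + 1)) * Fintype.card σ) := by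
  have hn : 0 < m + 1 := Nat.succ_pos m
  set N : ℝ := 2 ^ (m + 1) with hN
  set Ωc : ℝ := (Fintype.card (Sample σ (m + 1)) : ℝ) with hΩc
  have hNpos : 0 < N := by positivity
  have hΩpos : 0 < Ωc := by rw [hΩc]; exact_mod_cast Fintype.card_pos
  have hcBS : (0 : ℝ) < Fintype.card (Bool → σ) := by exact_mod_cast Fintype.card_pos
  have hcσ : (0 : ℝ) < Fintype.card σ := by exact_mod_cast Fintype.card_pos
  -- the two sums as sums of hybrid counts
  have e1 : (∑ i : Fin (2 ^ (m + 1)), ∑ ω : Sample σ (m + 1),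
      (#{z : Bool → σ | T (distFun g o ω i z) = true} : ℝ)) =
        Fintype.card (Bool → σ) * ∑ i : Fin (2 ^ (m + 1)), (hybCount g o T ((i : ℕ) + 1) : ℝ) := by
    exact_mod_cast sum_card_ideal_eq g o T
  have e2 : (∑ i : Fin (2 ^ (m + 1)), ∑ ω : Sample σ (m + 1),
      (#{s : σ | T (distFun g o ω i fun b => g b s) = true} : ℝ)) =
        Fintype.card σ * ∑ i : Fin (2 ^ (m + 1)), (hybCount g o T i : ℝ) := by
    exact_mod_cast sum_card_real_eq g o T hn
  rw [e1, e2]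
  have e3 : (Fintype.card (Bool → σ) : ℝ) * (∑ i : Fin (2 ^ (m + 1)),
      (hybCount g o T ((i : ℕ) + 1) : ℝ)) / (N * Ωc * Fintype.card (Bool → σ)) =
        (∑ i : Fin (2 ^ (m + 1)), (hybCount g o T ((i : ℕ) + 1) : ℝ)) / (N * Ωc) := by
    field_simp
  have e4 : (Fintype.card σ : ℝ) * (∑ i : Fin (2 ^ (m + 1)), (hybCount g o T i : ℝ)) /
      (N * Ωc * Fintype.card σ) =
        (∑ i : Fin (2 ^ (m + 1)), (hybCount g o T i : ℝ)) / (N * Ωc) := by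
    field_simp
  rw [e3, e4, ← sub_div, sum_hybCount_succ_sub g o T hn, hybCount_zero hA, Nat.cast_zero,
    sub_zero]
  -- the last hybrid accepts at least a `B`-fraction
  have hlast : B * Ωc ≤ hybCount g o T (2 ^ (m + 1) - 1) := by
    have h := hybCount_last_mul (g := g) ho hflip T
    have h' : (hybCount g o T (2 ^ (m + 1) - 1) : ℝ) * 2 ^ 2 ^ (m + 1) =
        Ωc * #{h : (Fin (m + 1) → Bool) → Bool | T h = true} := by
      rw [hΩc]; exact_mod_cast h
    nlinarith [hB, h', hΩpos, show (0 : ℝ) < 2 ^ 2 ^ (m + 1) from by positivity]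
  rw [div_le_div_iff₀ hNpos (mul_pos hNpos hΩpos)]
  nlinarith [hlast, hNpos]

end Literature.Computability.MetaComplexity
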